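import Mathlib
import Summits.Ventures.PercRepro2.Defs
import Summits.Ventures.PercRepro2.Graph
import Summits.Ventures.PercRepro2.Harris
import Summits.Ventures.PercRepro2.OneColourSwitch
import Summits.Ventures.PercRepro2.OneColourSwitchFibre
import Summits.Ventures.PercRepro2.M9PendantFibreSign

/-!
# Harris with the complement on a typed fibre (blind cell PercRepro2, p3 g16, 2026-08-27;
`proofs/P3-CPNC.md` §13)

On a fibre (`OneColourSwitch.fibre F z`: the free edges `F` coloured complementarily, the rest
pinned by `z` in both colours) the `W`-colour is `OneColourSwitch.flipOn F ω`.  For increasing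
events `A`, `B` of the configuration,
`#{ω ∈ fibre : ω ∈ B, flipOn F ω ∈ A} ≤ #{ω ∈ fibre : ω ∈ A ∩ B}`
(`card_filter_le_of_isUpperSet_fibre`).  Proof: the product measure `pinnedHalf F z` (`1/2` on
`F`, `z e` off `F`) is the uniform measure on the fibre; `{ω | ∃ ω' ∈ fibre, ω ≤ ω', flipOn F ω' ∈ A}`
is a lower set agreeing with `{flipOn F ω ∈ A}` on the fibre and of the same mass as `A` (the
fibre flip is an involution), so the tree's Harris (`prob_inter_le_prob_mul_prob_of_isLowerSet`,
`prob_mul_prob_le_prob_inter`) gives the bound.  The fibre analogue of `HarrisComplement`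
(mine-a g21).  Own work; std axioms.
-/

namespace Summit.Ventures.PercRepro2

namespace CutVertexM9

open Finset Classical

variable {E : Type*} [Fintype E] [DecidableEq E]

/-- The product measure of the fibre: `1/2` on the free edges `F`, the pinned value `z e`
(as `0` / `1`) off `F`. -/
noncomputable def pinnedHalf (F : Set E) (z : Config E) : E → ℚ :=
  fun e => if e ∈ F then 1 / 2 else (if z e then 1 else 0)

omit [Fintype E] [DecidableEq E] in
/-- `pinnedHalf` is an admissible weight vector. -/
lemma isProbVec_pinnedHalf (F : Set E) (z : Config E) : IsProbVec (pinnedHalf F z) :=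
  ⟨fun e => by unfold pinnedHalf; split_ifs <;> norm_num,
    fun e => by unfold pinnedHalf; split_ifs <;> norm_num⟩

omit [Fintype E] [DecidableEq E] in
/-- The edge factor of a free edge is `1/2`. -/
lemma edgeFactor_pinnedHalf_of_mem {F : Set E} {z : Config E} {e : E} (he : e ∈ F) (b : Bool) :
    edgeFactor (pinnedHalf F z e) b = 1 / 2 := by
  unfold pinnedHalf edgeFactor
  rw [if_pos he]
  cases b <;> norm_num

omit [Fintype E] [DecidableEq E] in
/-- The edge factor of a pinned edge is the indicator of agreement with `z`. -/
lemma edgeFactor_pinnedHalf_of_notMem {F : Set E} {z : Config E} {e : E} (he : e ∉ F) (b : Bool) :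
    edgeFactor (pinnedHalf F z e) b = if b = z e then 1 else 0 := by
  unfold pinnedHalf edgeFactor
  rw [if_neg he]
  cases b <;> cases hz : z e <;> simp

omit [DecidableEq E] in
/-- The weight of `pinnedHalf` is uniform on the fibre and `0` off it. -/
lemma weight_pinnedHalf (F : Set E) (z : Config E) (ω : Config E) :
    weight (pinnedHalf F z) ω =
      if ω ∈ OneColourSwitch.fibre F z then (1 / 2 : ℚ) ^ (univ.filter (· ∈ F)).card else 0 := by
  rw [weight_apply, ← Finset.prod_filter_mul_prod_filter_not univ (· ∈ F)]
  have h1 : ∏ e ∈ univ.filter (· ∈ F), edgeFactor (pinnedHalf F z e) (ω e) =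
      (1 / 2 : ℚ) ^ (univ.filter (· ∈ F)).card := by
    rw [Finset.prod_congr rfl
      (fun e he => edgeFactor_pinnedHalf_of_mem (Finset.mem_filter.1 he).2 (ω e)),
      Finset.prod_const]
  have h2 : ∏ e ∈ univ.filter (fun e => ¬ e ∈ F), edgeFactor (pinnedHalf F z e) (ω e) =
      if ω ∈ OneColourSwitch.fibre F z then (1 : ℚ) else 0 := by
    rw [Finset.prod_congr rfl
      (fun e he => edgeFactor_pinnedHalf_of_notMem (Finset.mem_filter.1 he).2 (ω e)),
      Finset.prod_boole]
    have hiff : (∀ e ∈ univ.filter (fun e => ¬ e ∈ F), ω e = z e) ↔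
        ω ∈ OneColourSwitch.fibre F z := by
      simp only [Finset.mem_filter, Finset.mem_univ, true_and, OneColourSwitch.fibre,
        Set.mem_setOf_eq]
    by_cases hfib : ω ∈ OneColourSwitch.fibre F z
    · rw [if_pos (hiff.2 hfib), if_pos hfib]
    · rw [if_neg (fun h => hfib (hiff.1 h)), if_neg hfib]
  rw [h1, h2]
  split_ifs <;> simp

/-- The `pinnedHalf`-probability of an event counts the fibre. -/
lemma prob_pinnedHalf (F : Set E) (z : Config E) (S : Set (Config E)) [DecidablePred (· ∈ S)] :
    prob (pinnedHalf F z) S =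
      (1 / 2 : ℚ) ^ (univ.filter (· ∈ F)).card *
        ((univ.filter (fun ω : Config E => ω ∈ OneColourSwitch.fibre F z ∧ ω ∈ S)).card : ℚ) := by
  unfold prob
  have hind : ∀ ω : Config E, S.indicator (weight (pinnedHalf F z)) ω =
      (1 / 2 : ℚ) ^ (univ.filter (· ∈ F)).card *
        (if ω ∈ OneColourSwitch.fibre F z ∧ ω ∈ S then (1 : ℚ) else 0) := by
    intro ω
    by_cases hS : ω ∈ S <;> by_cases hf : ω ∈ OneColourSwitch.fibre F z <;>
      simp [Set.indicator, hS, hf, weight_pinnedHalf]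
  rw [Finset.sum_congr rfl (fun ω _ => hind ω), ← Finset.mul_sum, Finset.sum_boole]

/-- Counting a filter after the fibre flip. -/
lemma card_filter_flipOn (F : Set E) (P : Config E → Prop) [DecidablePred P] :
    (univ.filter (fun ω : Config E => P (OneColourSwitch.flipOn F ω))).card =
      (univ.filter P).card :=
  Finset.card_equiv (OneColourSwitch.flipOnPerm F) (fun ω => by
    simp only [Finset.mem_filter, Finset.mem_univ, true_and, OneColourSwitch.flipOnPerm,
      Function.Involutive.coe_toPerm])

/-- **Harris with the complement on a fibre, counted**: for increasing `A`, `B`,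
`#{ω ∈ fibre : ω ∈ B, flipOn F ω ∈ A} ≤ #{ω ∈ fibre : ω ∈ A ∩ B}`. -/
theorem card_filter_le_of_isUpperSet_fibre (F : Set E) (z : Config E) {A B : Set (Config E)}
    (hA : IsUpperSet A) (hB : IsUpperSet B) (P Q : Config E → Prop) [DecidablePred P]
    [DecidablePred Q]
    (hP : ∀ ω, P ω ↔ ω ∈ OneColourSwitch.fibre F z ∧ ω ∈ A ∩ B)
    (hQ : ∀ ω, Q ω ↔ ω ∈ OneColourSwitch.fibre F z ∧ (ω ∈ B ∧ OneColourSwitch.flipOn F ω ∈ A)) :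
    (univ.filter Q).card ≤ (univ.filter P).card := by
  -- the lower set standing in for `{flipOn F ω ∈ A}` on the fibre
  let D : Set (Config E) :=
    {ω | ∃ ω' ∈ OneColourSwitch.fibre F z, ω ≤ ω' ∧ OneColourSwitch.flipOn F ω' ∈ A}
  have hD : IsLowerSet D := by
    intro ω ω₀ hle hω
    obtain ⟨ω', hω', hle', hA'⟩ := hω
    exact ⟨ω', hω', hle.trans hle', hA'⟩
  have hDfib : ∀ ω ∈ OneColourSwitch.fibre F z, (ω ∈ D ↔ OneColourSwitch.flipOn F ω ∈ A) := by
    intro ω hω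
    constructor
    · rintro ⟨ω', hω', hle, hA'⟩
      refine hA ?_ hA'
      intro e
      by_cases he : e ∈ F
      · rw [OneColourSwitch.flipOn_of_mem he, OneColourSwitch.flipOn_of_mem he]
        have h := hle e
        revert h
        cases ω e <;> cases ω' e <;> simp
      · rw [OneColourSwitch.flipOn_of_notMem he, OneColourSwitch.flipOn_of_notMem he, hω e he,
          hω' e he]
    · intro hA'
      exact ⟨ω, hω, le_rfl, hA'⟩
  have hp := isProbVec_pinnedHalf F z
  have h1 := prob_inter_le_prob_mul_prob_of_isLowerSet hp hD hB
  have h2 := prob_mul_prob_le_prob_inter hp hA hB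
  -- `D` has the mass of `A`
  have hDA : prob (pinnedHalf F z) D = prob (pinnedHalf F z) A := by
    rw [prob_pinnedHalf, prob_pinnedHalf]
    congr 2
    calc (univ.filter (fun ω : Config E => ω ∈ OneColourSwitch.fibre F z ∧ ω ∈ D)).card
        = (univ.filter (fun ω : Config E =>
            ω ∈ OneColourSwitch.fibre F z ∧ OneColourSwitch.flipOn F ω ∈ A)).card := by
          congr 1
          exact Finset.filter_congr (fun ω _ => and_congr_right (hDfib ω))
      _ = (univ.filter (fun ω : Config E =>
            OneColourSwitch.flipOn F ω ∈ OneColourSwitch.fibre F z ∧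
              OneColourSwitch.flipOn F ω ∈ A)).card := by
          congr 1
          exact Finset.filter_congr (fun ω _ =>
            and_congr_left (fun _ => OneColourSwitch.flipOn_mem_fibre.symm))
      _ = (univ.filter (fun ω : Config E => ω ∈ OneColourSwitch.fibre F z ∧ ω ∈ A)).card :=
          card_filter_flipOn F (fun ω => ω ∈ OneColourSwitch.fibre F z ∧ ω ∈ A)
  have hQ' : prob (pinnedHalf F z) (D ∩ B) =
      (1 / 2 : ℚ) ^ (univ.filter (· ∈ F)).card * ((univ.filter Q).card : ℚ) := by
    rw [prob_pinnedHalf]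
    congr 3
    exact Finset.filter_congr (fun ω _ => by
      rw [hQ]
      constructor
      · rintro ⟨hf, hDω, hBω⟩
        exact ⟨hf, hBω, (hDfib ω hf).1 hDω⟩
      · rintro ⟨hf, hBω, hAω⟩
        exact ⟨hf, (hDfib ω hf).2 hAω, hBω⟩)
  have hP' : prob (pinnedHalf F z) (A ∩ B) =
      (1 / 2 : ℚ) ^ (univ.filter (· ∈ F)).card * ((univ.filter P).card : ℚ) := by
    rw [prob_pinnedHalf]
    congr 3
    exact Finset.filter_congr (fun ω _ => (hP ω).symm)
  have hchain : prob (pinnedHalf F z) (D ∩ B) ≤ prob (pinnedHalf F z) (A ∩ B) := by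
    calc prob (pinnedHalf F z) (D ∩ B) ≤ prob (pinnedHalf F z) D * prob (pinnedHalf F z) B := h1
      _ = prob (pinnedHalf F z) A * prob (pinnedHalf F z) B := by rw [hDA]
      _ ≤ prob (pinnedHalf F z) (A ∩ B) := h2
  rw [hQ', hP'] at hchain
  have hpos : (0 : ℚ) < (1 / 2 : ℚ) ^ (univ.filter (· ∈ F)).card := by positivity
  exact_mod_cast le_of_mul_le_mul_left hchain hpos

end CutVertexM9

end Summit.Ventures.PercRepro2
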